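import Summits.QuantumFields.YangMills.Theorems.BalabanLadderIRTwistedSlabProductFrames
import Summits.QuantumFields.YangMills.Theorems.BalabanLadderIRTwistedSlabLaplacianDecor
import Summits.QuantumFields.YangMills.Theorems.BalabanLadderIRTwistedSlabTreeLevelDefect
import HarnessLib

/-!
# THE NUMBER: the tree-level (`β → ∞`) limit of the projected twisted slab at one box in CLOSED FORM —
# `β^{3|sites|d/2} · W_{ω^k,1}(β) → N · (2π)^{3|sites|d/2} · σ₁^{3|sites|} ∕ det_ℝ Δ` and
# `projSlabDefect → 1 − (det_ℝ Δ_t)² ∕ (qN · det_ℝ Δ_{2t})` (all window constants cancel)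

HELPER toward stub **T1** `TwistedSlabAnchor` (LINE `twisted-slab-continuity`, crux `IRcof` stmt-QuantumFields-26930, census row 43;
LEAD prover ym-ir-line-tsc-p1 g4; `--supports` the crux, `--as helper`).  Assembles K24 `tendsto_projSlabDefect_classical` (existence form), K27
(`det A_p = (det_ℝΔ)³`), K28 (`J_p(0) = √det_ℝΔ · σ₀(𝔤^E)`), K29 (`tendsto_laplace_sum_orbits_twistedExponent_pinned`), K29b (`0 < det_ℝΔ`,
decoration independence), K30a (product frames, `σ₀(𝔤^B) = σ₁^{|B|}`).  Proof file: theorems only.  Norm scope `Matrix.Norms.L2Operator`.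
* §1 ★★★ `tendsto_rpow_mul_twistedPartition_slab_closedForm`: for a twist-eating pair `B A B⁻¹ A⁻¹ = ω^k·1` (`k` a unit, `N(m+1) ≥ 2`) and any
  Frobenius-isometric frame `ι₁ : ℝ^d ≃L 𝔰𝔲(N)`,
  `β^{3Sd/2} · W_{ω^k,1}(β; (m+1)²×(m₂+1)×(m₃+1)) → N · (2π)^{3Sd/2} · σ₁^{3S} ∕ det_ℝ Δ_{A,B}` (`S = |sites|`, `d = dim 𝔰𝔲(N)`,
  `σ₁ = suSiteWindowConst (vol ∘ ι₁⁻¹)`, `Δ_{A,B}` = the real covariant Laplacian on `suFields` at the ladder `![A, B, 1•ω⁰, 1•ω⁰]`).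
* §2 ★★★ `tendsto_projSlabDefect_closedForm` — THE NUMBER: `projSlabDefect(β; z = ω^k, n, ℓ₀ = m+1, L = m₂+1, t = m₃+1) →
  1 − (det_ℝ Δ_t)² ∕ (N·q · det_ℝ Δ_{2t})` with `q = n⁻¹ · #{j < n : z^j = 1}` (`= 1/N` when `z^n = 1`): the Gaussian constants of the two boxes,
  NO window constant, NO power of `2π` left.
NOT here (honest scope): `det_ℝ Δ` as the spectral product `∏ (2 cosh(ω_λ t) − 2)` over the twisted momenta (lit-4 L27 `KroneckerSumDeterminant` — the
diagonalisation of `Δ` on `suFields` at the twist eater is K31); anything uniform in `β` (M3) or in `L, t` (M4); T1-box 0∕1, T1 proper 0∕1.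

HONEST FRAMING: the classical limit at ONE fixed box, now a closed-form number; nothing here bears on `IRcof`, `IR`, or the Yang–Mills mass gap
(Clay: NOT proved); R4 = `BalabanLadder.UV` only.  References: M. García Pérez, A. González-Arroyo, M. Okawa, JHEP 10 (2017) 150 §2.5; K. W. Breitung
(1994) Thm 41; S. Helgason (2000) Ch. I §1 Thm 1.14 (13); T. Bałaban, CMP 102 (1985) p. 260.
-/

set_option autoImplicit false

noncomputable section

open scoped Matrix Matrix.Norms.L2Operator Topology ENNReal InnerProductSpace
open MeasureTheory Filter Set Metric Module WithLp
open Literature.MathematicalPhysics.QuantumFieldTheory Literature.MathematicalPhysics.QuantumLattice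
open Literature.MathematicalPhysics.QuantumFieldTheory.Balaban1983to89
open Literature.MathematicalPhysics.QuantumFieldTheory.Balaban1983to89.LogChartProduct
open Literature.Analysis.Asymptotics Literature.Analysis.OperatorTheory Literature.Analysis.InnerProduct

namespace Summit.QuantumFields.YangMills.Cruxes.IRcof.TwistedSlab

variable {N : ℕ} [NeZero N]

/-! ## §1 The closed-form constant of one box -/

section Box

variable {m m₂ m₃ : ℕ} {k : ZMod N} {A B : Matrix.specialUnitaryGroup (Fin N) ℂ}

/-- ★★★ **THE TREE-LEVEL CONSTANT OF ONE BOX IN CLOSED FORM**: for a twist-eating pair (`B A B⁻¹ A⁻¹ = ω^k·1`, `k` a unit, `N(m+1) ≥ 2`) and a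
Frobenius-isometric frame `ι₁ : ℝ^d ≃L 𝔰𝔲(N)`,
`β^{3Sd/2} · W_{ω^k,1}(β) → N · (2π)^{3Sd/2} · σ₁^{3S} ∕ det_ℝ Δ_{A,B}` (`S = (m+1)²(m₂+1)(m₃+1)`, `d = dim 𝔰𝔲(N)`, `σ₁ = suSiteWindowConst (vol∘ι₁⁻¹)`).
K29's pinned Laplace asymptotics at the product frames of K30a, with K28's Jacobian, K27's Gaussian determinant and K29b's decoration independence.
[cite: GarciaperezGonzalezarroyoOkawa2017, §2.5] [cite: Breitung1994, Thm 41] [cite: Helgason2000, Ch. I §1 Thm 1.14 (13) p. 96] -/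
theorem tendsto_rpow_mul_twistedPartition_slab_closedForm (hk : IsUnit k)
    (hAB : B * A * B⁻¹ * A⁻¹ = (suCenter N k : Matrix.specialUnitaryGroup (Fin N) ℂ)) (hNm : 2 ≤ N * (m + 1))
    (ι₁ : EuclideanSpace ℝ (Fin (finrank ℝ (specialUnitaryLogChart (Fin N)).lie)) ≃L[ℝ] (specialUnitaryLogChart (Fin N)).lie)
    (hι₁ : ∀ u u', ⟪u, u'⟫_ℝ = ((((ι₁ u : (specialUnitaryLogChart (Fin N)).lie) : Matrix (Fin N) (Fin N) ℂ)ᴴ *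
      ((ι₁ u' : (specialUnitaryLogChart (Fin N)).lie) : Matrix (Fin N) (Fin N) ℂ)).trace).re) :
    letI : MeasurableSpace (specialUnitaryLogChart (Fin N)).lie := borel _
    Tendsto (fun β : ℝ =>
      β ^ ((3 * ((m + 1) * (m + 1) * (m₂ + 1) * (m₃ + 1) * finrank ℝ (specialUnitaryLogChart (Fin N)).lie) : ℕ) / 2 : ℝ) *
        wilsonFinTorusTensorTwistedPartition (fundamentalRep (Fin N)) β (slabTwist (suCenter N k : Matrix.specialUnitaryGroup (Fin N) ℂ) 1)
          (m + 1) (m + 1) (m₂ + 1) (m₃ + 1)) atTop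
      (𝓝 ((N : ℝ) * (2 * Real.pi) ^ ((3 * ((m + 1) * (m + 1) * (m₂ + 1) * (m₃ + 1) * finrank ℝ (specialUnitaryLogChart (Fin N)).lie) : ℕ) / 2 : ℝ) *
        suSiteWindowConst ((volume : Measure (EuclideanSpace ℝ (Fin (finrank ℝ (specialUnitaryLogChart (Fin N)).lie)))).map ι₁) ^
          (3 * ((m + 1) * (m + 1) * (m₂ + 1) * (m₃ + 1))) /
        LinearMap.det (DiscreteWeitzenboeck.covLaplacian
          (suD (fun e => Matrix.specialUnitaryGroup_le_unitaryGroup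
            (ladderFieldPair_mem_specialUnitaryGroup (n₀ := m + 1) (n₁ := m + 1) (n₂ := m₂ + 1) (n₃ := m₃ + 1) A B 0 0 e)))
          (suDadj (fun e => Matrix.specialUnitaryGroup_le_unitaryGroup
            (ladderFieldPair_mem_specialUnitaryGroup (n₀ := m + 1) (n₁ := m + 1) (n₂ := m₂ + 1) (n₃ := m₃ + 1) A B 0 0 e)))))) := by
  classical
  letI : MeasurableSpace (specialUnitaryLogChart (Fin N)).lie := borel _
  haveI : BorelSpace (specialUnitaryLogChart (Fin N)).lie := ⟨rfl⟩
  letI : MeasurableSpace (piLogChart (specialUnitaryLogChart (Fin N)) (FinTorusSite (m + 1) (m + 1) (m₂ + 1) (m₃ + 1))).lie := borel _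
  haveI : BorelSpace (piLogChart (specialUnitaryLogChart (Fin N)) (FinTorusSite (m + 1) (m + 1) (m₂ + 1) (m₃ + 1))).lie := ⟨rfl⟩
  letI : MeasurableSpace (piLogChart (specialUnitaryLogChart (Fin N)) (FinTorusSite (m + 1) (m + 1) (m₂ + 1) (m₃ + 1) × Fin 4)).lie := borel _
  haveI : BorelSpace (piLogChart (specialUnitaryLogChart (Fin N)) (FinTorusSite (m + 1) (m + 1) (m₂ + 1) (m₃ + 1) × Fin 4)).lie := ⟨rfl⟩
  have hAu : (A : Matrix (Fin N) (Fin N) ℂ) ∈ Matrix.unitaryGroup (Fin N) ℂ := Matrix.specialUnitaryGroup_le_unitaryGroup A.2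
  have hBu : (B : Matrix (Fin N) (Fin N) ℂ) ∈ Matrix.unitaryGroup (Fin N) ℂ := Matrix.specialUnitaryGroup_le_unitaryGroup B.2
  have hω := isPrimitiveRoot_star_centerPhase (N := N) hk
  have hAB' := coe_mul_eq_smul_of_commutator_eq hAB
  have hL : ∀ p : ZMod N × ZMod N, ∀ e : FinTorusSite (m + 1) (m + 1) (m₂ + 1) (m₃ + 1) × Fin 4,
      ladderField ![(A : Matrix (Fin N) (Fin N) ℂ), (B : Matrix (Fin N) (Fin N) ℂ), centerPhase N p.1 • (1 : Matrix (Fin N) (Fin N) ℂ),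
        centerPhase N p.2 • (1 : Matrix (Fin N) (Fin N) ℂ)] e ∈ Matrix.specialUnitaryGroup (Fin N) ℂ :=
    fun p => ladderFieldPair_mem_specialUnitaryGroup A B p.1 p.2
  set σ₁ := suSiteWindowConst ((volume : Measure (EuclideanSpace ℝ (Fin (finrank ℝ (specialUnitaryLogChart (Fin N)).lie)))).map ι₁) with hσ₁
  have hσ₁pos : 0 < σ₁ := suSiteWindowConst_map_pos ι₁
  -- the frames (K30a, K27)
  set T_M := sitesFrame ι₁ (m + 1) (m + 1) (m₂ + 1) (m₃ + 1) with hT_Mdef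
  have hT_M := inner_eq_sPairing_sitesFrame ι₁ (m + 1) (m + 1) (m₂ + 1) (m₃ + 1) hι₁
  have hfin : ∀ p : ZMod N × ZMod N, 3 * ((m + 1) * (m + 1) * (m₂ + 1) * (m₃ + 1) * finrank ℝ (specialUnitaryLogChart (Fin N)).lie) = finrank ℝ (realCoulombSlice (ladderField (n₀ := m + 1) (n₁ := m + 1) (n₂ := m₂ + 1) (n₃ := m₃ + 1)
      ![(A : Matrix (Fin N) (Fin N) ℂ), (B : Matrix (Fin N) (Fin N) ℂ), centerPhase N p.1 • (1 : Matrix (Fin N) (Fin N) ℂ), centerPhase N p.2 • (1 : Matrix (Fin N) (Fin N) ℂ)])) := by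
    intro p
    exact (finrank_realCoulombSlice_ladder hAu hBu hω hAB' hNm (fun e => Matrix.specialUnitaryGroup_le_unitaryGroup (hL p e))).symm
  choose T₀ hT₀ using fun p : ZMod N × ZMod N => exists_isometricFrame (N := N) (ladderField (n₀ := m + 1) (n₁ := m + 1) (n₂ := m₂ + 1) (n₃ := m₃ + 1)
    ![(A : Matrix (Fin N) (Fin N) ℂ), (B : Matrix (Fin N) (Fin N) ℂ), centerPhase N p.1 • (1 : Matrix (Fin N) (Fin N) ℂ), centerPhase N p.2 • (1 : Matrix (Fin N) (Fin N) ℂ)])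
  set κ : ∀ p : ZMod N × ZMod N, EuclideanSpace ℝ (Fin (3 * ((m + 1) * (m + 1) * (m₂ + 1) * (m₃ + 1) * finrank ℝ (specialUnitaryLogChart (Fin N)).lie))) ≃ₗᵢ[ℝ]
      EuclideanSpace ℝ (Fin (finrank ℝ (realCoulombSlice (ladderField (n₀ := m + 1) (n₁ := m + 1) (n₂ := m₂ + 1) (n₃ := m₃ + 1)
        ![(A : Matrix (Fin N) (Fin N) ℂ), (B : Matrix (Fin N) (Fin N) ℂ), centerPhase N p.1 • (1 : Matrix (Fin N) (Fin N) ℂ), centerPhase N p.2 • (1 : Matrix (Fin N) (Fin N) ℂ)])))) :=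
    fun p => LinearIsometryEquiv.piLpCongrLeft 2 ℝ ℝ (finCongr (hfin p)) with hκ
  set T_V : ∀ p : ZMod N × ZMod N, EuclideanSpace ℝ (Fin (3 * ((m + 1) * (m + 1) * (m₂ + 1) * (m₃ + 1) * finrank ℝ (specialUnitaryLogChart (Fin N)).lie))) ≃L[ℝ]
      realCoulombSlice (ladderField (n₀ := m + 1) (n₁ := m + 1) (n₂ := m₂ + 1) (n₃ := m₃ + 1)
        ![(A : Matrix (Fin N) (Fin N) ℂ), (B : Matrix (Fin N) (Fin N) ℂ), centerPhase N p.1 • (1 : Matrix (Fin N) (Fin N) ℂ), centerPhase N p.2 • (1 : Matrix (Fin N) (Fin N) ℂ)]) :=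
    fun p => (κ p).toContinuousLinearEquiv.trans (T₀ p) with hT_V
  have hT_Vi : ∀ (p : ZMod N × ZMod N) (y y' : EuclideanSpace ℝ (Fin (3 * ((m + 1) * (m + 1) * (m₂ + 1) * (m₃ + 1) * finrank ℝ (specialUnitaryLogChart (Fin N)).lie)))),
      ⟪y, y'⟫_ℝ = hsPairing ((T_V p y : realCoulombSlice _) : Fin 4 → FinTorusSite (m + 1) (m + 1) (m₂ + 1) (m₃ + 1) → Matrix (Fin N) (Fin N) ℂ)
        ((T_V p y' : realCoulombSlice _) : Fin 4 → FinTorusSite (m + 1) (m + 1) (m₂ + 1) (m₃ + 1) → Matrix (Fin N) (Fin N) ℂ) := by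
    intro p y y'
    rw [← (κ p).inner_map_map]
    exact hT₀ p _ _
  set R := piFrame ι₁ (FinTorusSite (m + 1) (m + 1) (m₂ + 1) (m₃ + 1) × Fin 4) with hRdef
  have hR := inner_eq_ePairing_piFrame ι₁ (FinTorusSite (m + 1) (m + 1) (m₂ + 1) (m₃ + 1) × Fin 4) hι₁
  -- the pinned Laplace asymptotics (K29) with `φ ≡ 1`
  have hlim := tendsto_laplace_sum_orbits_twistedExponent_pinned (M := PiLp 2 (fun _ : FinTorusSite (m + 1) (m + 1) (m₂ + 1) (m₃ + 1) =>
      EuclideanSpace ℝ (Fin (finrank ℝ (specialUnitaryLogChart (Fin N)).lie)))) (V := EuclideanSpace ℝ (Fin (3 * ((m + 1) * (m + 1) * (m₂ + 1) * (m₃ + 1) * finrank ℝ (specialUnitaryLogChart (Fin N)).lie))))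
    hk hAB hNm T_M T_V (φ := fun _ => (1 : ℝ)) continuous_const (fun _ _ => rfl)
  rw [finrank_euclideanSpace_fin] at hlim
  -- the orbit data in closed form
  have hJ : ∀ p : ZMod N × ZMod N,
      fibredChartDensity (hL p) (slicePsiSuDeriv hAu hBu hω hAB' hNm (hL p)) (prodFrame T_M (T_V p))
          (Measure.pi fun _ : FinTorusSite (m + 1) (m + 1) (m₂ + 1) (m₃ + 1) × Fin 4 => haarProbability (Matrix.specialUnitaryGroup (Fin N) ℂ)) 0 =
        Real.sqrt (LinearMap.det (DiscreteWeitzenboeck.covLaplacian (suD fun e => (Matrix.mem_specialUnitaryGroup_iff.1 (hL p e)).1)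
          (suDadj fun e => (Matrix.mem_specialUnitaryGroup_iff.1 (hL p e)).1))) * σ₁ ^ ((m + 1) * (m + 1) * (m₂ + 1) * (m₃ + 1) * 4) := by
    intro p
    have h := fibredChartDensity_zero_eq_sqrt_det_mul hAu hBu hω hAB' hNm (hL p) T_M hT_M (T_V p) (hT_Vi p) R hR
      (Measure.pi fun _ : FinTorusSite (m + 1) (m + 1) (m₂ + 1) (m₃ + 1) × Fin 4 => haarProbability (Matrix.specialUnitaryGroup (Fin N) ℂ))
    rw [h, hRdef, suPiWindowConst_piFrame ι₁ (FinTorusSite (m + 1) (m + 1) (m₂ + 1) (m₃ + 1) × Fin 4), Fintype.card_prod, card_finTorusSite,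
      Fintype.card_fin]
  have hσM : suPiWindowConst (FinTorusSite (m + 1) (m + 1) (m₂ + 1) (m₃ + 1))
      ((volume : Measure (PiLp 2 (fun _ : FinTorusSite (m + 1) (m + 1) (m₂ + 1) (m₃ + 1) =>
        EuclideanSpace ℝ (Fin (finrank ℝ (specialUnitaryLogChart (Fin N)).lie))))).map fun z => suFieldsLie (T_M z))
      (Measure.pi fun _ : FinTorusSite (m + 1) (m + 1) (m₂ + 1) (m₃ + 1) => haarProbability (Matrix.specialUnitaryGroup (Fin N) ℂ)) = σ₁ ^ ((m + 1) * (m + 1) * (m₂ + 1) * (m₃ + 1)) := by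
    have hfun : (fun z => suFieldsLie (T_M z)) = ⇑(piFrame ι₁ (FinTorusSite (m + 1) (m + 1) (m₂ + 1) (m₃ + 1))) := by
      funext z; exact suFieldsLie_sitesFrame ι₁ (m + 1) (m + 1) (m₂ + 1) (m₃ + 1) z
    rw [hfun, suPiWindowConst_piFrame ι₁ (FinTorusSite (m + 1) (m + 1) (m₂ + 1) (m₃ + 1)), card_finTorusSite]
  have hA : ∀ p : ZMod N × ZMod N, LinearMap.det (sliceHessian (fun e => (⟨ladderField (n₀ := m + 1) (n₁ := m + 1) (n₂ := m₂ + 1) (n₃ := m₃ + 1)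
      ![(A : Matrix (Fin N) (Fin N) ℂ), (B : Matrix (Fin N) (Fin N) ℂ), centerPhase N p.1 • (1 : Matrix (Fin N) (Fin N) ℂ),
        centerPhase N p.2 • (1 : Matrix (Fin N) (Fin N) ℂ)] e, hL p e⟩ : Matrix.specialUnitaryGroup (Fin N) ℂ)) (T_V p) k) =
      LinearMap.det (DiscreteWeitzenboeck.covLaplacian
        (suD (fun e => Matrix.specialUnitaryGroup_le_unitaryGroup (ladderFieldPair_mem_specialUnitaryGroup (n₀ := m + 1) (n₁ := m + 1) (n₂ := m₂ + 1) (n₃ := m₃ + 1) A B 0 0 e)))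
        (suDadj (fun e => Matrix.specialUnitaryGroup_le_unitaryGroup (ladderFieldPair_mem_specialUnitaryGroup (n₀ := m + 1) (n₁ := m + 1) (n₂ := m₂ + 1) (n₃ := m₃ + 1) A B 0 0 e)))) ^ 3 := by
    intro p
    rw [det_sliceHessian_eq_of_isometric hk hAB hNm (T_V p) (hT_Vi p), covLaplacian_ladder_pair_eq A B p.1 p.2 0 0]
  have hΔp : ∀ p : ZMod N × ZMod N, LinearMap.det (DiscreteWeitzenboeck.covLaplacian (suD fun e => (Matrix.mem_specialUnitaryGroup_iff.1 (hL p e)).1)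
      (suDadj fun e => (Matrix.mem_specialUnitaryGroup_iff.1 (hL p e)).1)) =
      LinearMap.det (DiscreteWeitzenboeck.covLaplacian
        (suD (fun e => Matrix.specialUnitaryGroup_le_unitaryGroup (ladderFieldPair_mem_specialUnitaryGroup (n₀ := m + 1) (n₁ := m + 1) (n₂ := m₂ + 1) (n₃ := m₃ + 1) A B 0 0 e)))
        (suDadj (fun e => Matrix.specialUnitaryGroup_le_unitaryGroup (ladderFieldPair_mem_specialUnitaryGroup (n₀ := m + 1) (n₁ := m + 1) (n₂ := m₂ + 1) (n₃ := m₃ + 1) A B 0 0 e)))) :=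
    fun p => congrArg LinearMap.det (covLaplacian_ladder_pair_eq A B p.1 p.2 0 0)
  set Δ := LinearMap.det (DiscreteWeitzenboeck.covLaplacian
        (suD (fun e => Matrix.specialUnitaryGroup_le_unitaryGroup (ladderFieldPair_mem_specialUnitaryGroup (n₀ := m + 1) (n₁ := m + 1) (n₂ := m₂ + 1) (n₃ := m₃ + 1) A B 0 0 e)))
        (suDadj (fun e => Matrix.specialUnitaryGroup_le_unitaryGroup (ladderFieldPair_mem_specialUnitaryGroup (n₀ := m + 1) (n₁ := m + 1) (n₂ := m₂ + 1) (n₃ := m₃ + 1) A B 0 0 e)))) with hΔdef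
  have hΔpos : 0 < Δ := det_covLaplacian_ladder_pos (m₂ := m₂) (m₃ := m₃) hk hAB hNm 0 0
  have hsq3 : Real.sqrt (Δ ^ 3) = Δ * Real.sqrt Δ := by
    rw [pow_succ, Real.sqrt_mul (pow_nonneg hΔpos.le 2), Real.sqrt_sq hΔpos.le]
  -- assemble
  simp only [mul_one] at hlim
  have hfg : (fun β : ℝ => β ^ ((3 * ((m + 1) * (m + 1) * (m₂ + 1) * (m₃ + 1) * finrank ℝ (specialUnitaryLogChart (Fin N)).lie) : ℕ) / 2 : ℝ) *
      wilsonFinTorusTensorTwistedPartition (fundamentalRep (Fin N)) β (slabTwist (suCenter N k : Matrix.specialUnitaryGroup (Fin N) ℂ) 1)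
        (m + 1) (m + 1) (m₂ + 1) (m₃ + 1)) =
      fun β : ℝ => β ^ ((3 * ((m + 1) * (m + 1) * (m₂ + 1) * (m₃ + 1) * finrank ℝ (specialUnitaryLogChart (Fin N)).lie) : ℕ) / 2 : ℝ) *
        ∫ U : FinTorusSite (m + 1) (m + 1) (m₂ + 1) (m₃ + 1) × Fin 4 → Matrix.specialUnitaryGroup (Fin N) ℂ, Real.exp (-β * twistedExponent k U)
          ∂(Measure.pi fun _ => haarProbability (Matrix.specialUnitaryGroup (Fin N) ℂ)) := by
    funext β
    rw [wilsonFinTorusTensorTwistedPartition_slab_fundamental]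
  rw [hfg]
  convert hlim using 2
  simp only [hJ, hΔp, hA, hσM, probReal_univ, one_mul, hsq3, Finset.sum_const, Finset.card_univ, Fintype.card_prod, ZMod.card,
    nsmul_eq_mul, Nat.cast_mul]
  have hN0 : (N : ℝ) ≠ 0 := Nat.cast_ne_zero.2 (NeZero.ne N)
  have hsqrt : Real.sqrt Δ ≠ 0 := (Real.sqrt_pos.2 hΔpos).ne'
  have hpow : σ₁ ^ ((m + 1) * (m + 1) * (m₂ + 1) * (m₃ + 1) * 4) =
      σ₁ ^ ((m + 1) * (m + 1) * (m₂ + 1) * (m₃ + 1)) * σ₁ ^ (3 * ((m + 1) * (m + 1) * (m₂ + 1) * (m₃ + 1))) := by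
    rw [← pow_add]; congr 1; ring
  rw [hpow]
  field_simp

end Box

/-! ## §2 THE NUMBER: the tree-level limit of the projected defect in closed form -/

section TheNumber

variable {m m₂ m₃ : ℕ} {k : ZMod N} {A B : Matrix.specialUnitaryGroup (Fin N) ℂ}

/-- ★★★ **THE NUMBER.**  For `N ≥ 2`, a unit `k`, `n ≥ 1` and a twist-eating pair `B A B⁻¹ A⁻¹ = ω^k·1`:
`projSlabDefect(β; ω^k, n; ℓ₀ = m+1, L = m₂+1, t = m₃+1) → 1 − (det_ℝ Δ_t)² ∕ (N q · det_ℝ Δ_{2t})` as `β → ∞`, where `Δ_t`, `Δ_{2t}` are the real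
covariant Laplacians on `suFields` at the ladder `![A, B, 1, 1]` in the boxes `(m+1)² × (m₂+1) × (m₃+1)` and `(m+1)² × (m₂+1) × 2(m₃+1)`, and
`q = n⁻¹ · #{j < n : (ω^k·1)^j = 1}` (`N q = 1` when `z^n = 1`).  Every window constant and every power of `2π` cancels (K24 existence form +
§1 + `tendsto_nhds_unique`). [cite: GarciaperezGonzalezarroyoOkawa2017, §2.5] [cite: Breitung1994, Thm 41] -/
theorem tendsto_projSlabDefect_closedForm (hN : 2 ≤ N) (hk : IsUnit k) {n : ℕ} (hn : 0 < n)
    (hAB : B * A * B⁻¹ * A⁻¹ = (suCenter N k : Matrix.specialUnitaryGroup (Fin N) ℂ)) :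
    Tendsto (fun β : ℝ => projSlabDefect (fundamentalRep (Fin N)) β (suCenter N k : Matrix.specialUnitaryGroup (Fin N) ℂ) n (m + 1) (m₂ + 1) (m₃ + 1))
      atTop (𝓝 (1 -
        LinearMap.det (DiscreteWeitzenboeck.covLaplacian
          (suD (fun e => Matrix.specialUnitaryGroup_le_unitaryGroup
            (ladderFieldPair_mem_specialUnitaryGroup (n₀ := m + 1) (n₁ := m + 1) (n₂ := m₂ + 1) (n₃ := m₃ + 1) A B 0 0 e)))
          (suDadj (fun e => Matrix.specialUnitaryGroup_le_unitaryGroup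
            (ladderFieldPair_mem_specialUnitaryGroup (n₀ := m + 1) (n₁ := m + 1) (n₂ := m₂ + 1) (n₃ := m₃ + 1) A B 0 0 e)))) ^ 2 /
        ((N : ℝ) * ((n : ℝ)⁻¹ * ((Finset.univ.filter fun j : Fin n =>
            (suCenter N k : Matrix.specialUnitaryGroup (Fin N) ℂ) ^ (j : ℕ) = 1).card : ℝ)) *
          LinearMap.det (DiscreteWeitzenboeck.covLaplacian
            (suD (fun e => Matrix.specialUnitaryGroup_le_unitaryGroup
              (ladderFieldPair_mem_specialUnitaryGroup (n₀ := m + 1) (n₁ := m + 1) (n₂ := m₂ + 1) (n₃ := 2 * m₃ + 1 + 1) A B 0 0 e)))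
            (suDadj (fun e => Matrix.specialUnitaryGroup_le_unitaryGroup
              (ladderFieldPair_mem_specialUnitaryGroup (n₀ := m + 1) (n₁ := m + 1) (n₂ := m₂ + 1) (n₃ := 2 * m₃ + 1 + 1) A B 0 0 e))))))) := by
  classical
  letI : MeasurableSpace (specialUnitaryLogChart (Fin N)).lie := borel _
  haveI : BorelSpace (specialUnitaryLogChart (Fin N)).lie := ⟨rfl⟩
  obtain ⟨ι₁, hι₁⟩ := exists_suFrame (N := N)
  have hNm : 2 ≤ N * (m + 1) := le_trans hN (Nat.le_mul_of_pos_right N (Nat.succ_pos m))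
  obtain ⟨C₁, C₂, q, -, -, hq, h₁, h₂, hq', hdef⟩ := tendsto_projSlabDefect_classical (m := m) (m₂ := m₂) (m₃ := m₃) hN hk hn
  have e₁ := tendsto_nhds_unique h₁ (tendsto_rpow_mul_twistedPartition_slab_closedForm (m₂ := m₂) (m₃ := m₃) hk hAB hNm ι₁ hι₁)
  have e₂ := tendsto_nhds_unique h₂ (tendsto_rpow_mul_twistedPartition_slab_closedForm (m₂ := m₂) (m₃ := 2 * m₃ + 1) hk hAB hNm ι₁ hι₁)
  have eq := tendsto_nhds_unique hq' (tendsto_projSlabZ_div_twistedPartition (m₀ := m) (m₂ := m₂) (m₃ := m₃) hk hn).1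
  rw [e₁, e₂] at hdef
  rw [eq] at hdef hq
  convert hdef using 2
  -- the algebra: every window constant and every power of `2π` cancels
  set σ₁ := suSiteWindowConst ((volume : Measure (EuclideanSpace ℝ (Fin (finrank ℝ (specialUnitaryLogChart (Fin N)).lie)))).map ι₁) with hσ₁
  have hσ₁pos : 0 < σ₁ := suSiteWindowConst_map_pos ι₁
  have hΔ₁ := det_covLaplacian_ladder_pos (m₂ := m₂) (m₃ := m₃) hk hAB hNm 0 0
  have hΔ₂ := det_covLaplacian_ladder_pos (m₂ := m₂) (m₃ := 2 * m₃ + 1) hk hAB hNm 0 0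
  have hN0 : (N : ℝ) ≠ 0 := Nat.cast_ne_zero.2 (NeZero.ne N)
  have h2π : 0 < 2 * Real.pi := by positivity
  have hS : (m + 1) * (m + 1) * (m₂ + 1) * (2 * m₃ + 1 + 1) = 2 * ((m + 1) * (m + 1) * (m₂ + 1) * (m₃ + 1)) := by ring
  have hc : (2 * Real.pi) ^ ((3 * ((m + 1) * (m + 1) * (m₂ + 1) * (2 * m₃ + 1 + 1) * finrank ℝ (specialUnitaryLogChart (Fin N)).lie) : ℕ) / 2 : ℝ) =
      ((2 * Real.pi) ^ ((3 * ((m + 1) * (m + 1) * (m₂ + 1) * (m₃ + 1) * finrank ℝ (specialUnitaryLogChart (Fin N)).lie) : ℕ) / 2 : ℝ)) ^ 2 := by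
    rw [← Real.rpow_natCast _ 2, ← Real.rpow_mul h2π.le]
    congr 1
    rw [show 3 * ((m + 1) * (m + 1) * (m₂ + 1) * (2 * m₃ + 1 + 1) * finrank ℝ (specialUnitaryLogChart (Fin N)).lie) =
      2 * (3 * ((m + 1) * (m + 1) * (m₂ + 1) * (m₃ + 1) * finrank ℝ (specialUnitaryLogChart (Fin N)).lie)) by ring]
    push_cast
    ring
  have hs : σ₁ ^ (3 * ((m + 1) * (m + 1) * (m₂ + 1) * (2 * m₃ + 1 + 1))) = (σ₁ ^ (3 * ((m + 1) * (m + 1) * (m₂ + 1) * (m₃ + 1)))) ^ 2 := by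
    rw [← pow_mul, hS]; congr 1; ring
  have hcpos : 0 < (2 * Real.pi) ^ ((3 * ((m + 1) * (m + 1) * (m₂ + 1) * (m₃ + 1) * finrank ℝ (specialUnitaryLogChart (Fin N)).lie) : ℕ) / 2 : ℝ) :=
    Real.rpow_pos_of_pos h2π _
  rw [hc, hs]
  field_simp

end TheNumber

end Summit.QuantumFields.YangMills.Cruxes.IRcof.TwistedSlab

end
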